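import Literature.MathematicalPhysics.KineticTheory.DiPernaLionsConservationProofs
import Literature.Analysis.FunctionSpaces.UnifIntegrableDomination
import HarnessLib

/-!
# The loss term of the approximating sequence as a velocity convolution: estimates

Topic: MathematicalPhysics / KineticTheory. The estimates behind the loss half of CIP 1994 §5.3
Lemma 5.3.7 (weak `L¹` compactness of `Q⁻ₙ(fⁿ,fⁿ)/(1+fⁿ)` on `(0,T) × ℝ^d × B_R`), for the
DiPerna–Lions approximating sequence (`IsDiPernaLionsApproximateSolution`,
`IsDiPernaLionsKernelApproximation`), in lower-Lebesgue-integral form so that no integrability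
side conditions arise. Everything is proved; the file declares theorems only.

* Angular integral `A(z) = ∫ B((z,0),ω) dω` (`kernelAngularIntegral`): nonnegativity,
  measurability, boundedness for bounded kernels, `ofReal A = ∫⁻ ofReal B`, and the angular mass
  of balls (`setLIntegral_ofReal_kernelAngularIntegral`).
* `lossWith_eq_mul_integral_kernelAngularIntegral`: for a Galilean-invariant kernel,
  `Q⁻_B(g,g)(v) = g(v) (A ∗ g)(v)` (CIP 1994 §5.3 Step 3, "`Q⁻(f,f) = f R(f)`, `R(f) = A ∗ f`");
  `enorm_loss_term_le_lintegral`, `IsDiPernaLionsApproximateSolution.enorm_loss_term_le`: the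
  normalised renormalised loss term is dominated by `∫⁻ ofReal (A(v-w) f(w)) dw`
  (Lemma 5.3.7: "`Q⁻ⁿ(fⁿ,fⁿ)/(1+fⁿ) ≤ Aₙ ∗ fⁿ`").
* `exists_uniform_angular_mass`: `sup_n ∫_{|z| ≤ K} Aₙ < ∞` — here the `L¹_loc` convergence
  `Bₙ → B` of `IsDiPernaLionsKernelApproximation.tendsto_setLIntegral` is used (CIP p. 149:
  "`aₙ = ‖Aₙ‖_{L¹}` can be assumed to be bounded uniformly in `n`"; (3.12) alone does not give it).
* Slab Tonelli: `lintegral_slab_kernel_swap`, `volume_restrict_slab_ball`, `lintegral_slab_ball_eq`.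
* The three parts of `Aₙ ∗ fⁿ` (near/bounded, near/tail, far): `lintegral_conv_eq_near_add_far`,
  `lintegral_near_eq_bdd_add_tail`, `lintegral_near_bdd_le` (`≤ M ∫_{|u|≤K} A`),
  `lintegral_slab_near_conv_eq` (`∫_{slab} near part against Ψ = (∫_{|u|≤K} A) ∫_{slab} Ψ`),
  `lintegral_far_le_of_growth` (the far part on `(0,T) × E × B̄_R` is `≤ ε ∫_{slab} (1+|w|²) fⁿ`
  once `K ≥ R + ρ_ε`, by the growth condition (3.12) at `-w`; CIP p. 150).
* Application lemmas: `measurable_clamp_uncurry`, `lintegral_slab_weight_le` (slab bounds from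
  (3.21)–(3.22)), `ofReal_sub_min_le_enorm_indicator` (height tail = equi-integrability tail),
  `setLIntegral_ofReal_le_of_growth` ((3.12) in `∫⁻` form).

## References

* C. Cercignani, R. Illner, M. Pulvirenti, *The Mathematical Theory of Dilute Gases*, Springer
  (1994), §5.3 Step 3 (p. 143), Lemma 5.3.7 and its proof, pp. 148–150.
-/

open MeasureTheory Metric Real Set Filter Topology
open scoped InnerProductSpace ENNReal NNReal

noncomputable section

namespace Literature.MathematicalPhysics.KineticTheory

open Literature.Analysis.FluidPDE

variable {E : Type*} [NormedAddCommGroup E] [InnerProductSpace ℝ E] [FiniteDimensional ℝ E]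
  [MeasurableSpace E] [BorelSpace E]

/-! ## The angular integral of a kernel -/

section Angular

variable {B : E × E → sphere (0 : E) 1 → ℝ}

/-- `A(z) = ∫ B((z,0), ω) dω ≥ 0` for `B ≥ 0`. [folklore] -/
theorem kernelAngularIntegral_nonneg (hB0 : ∀ p ω, 0 ≤ B p ω) (z : E) :
    0 ≤ kernelAngularIntegral B z :=
  integral_nonneg fun _ => hB0 _ _

/-- The angular integral of a measurable kernel is measurable. [folklore] -/
theorem measurable_kernelAngularIntegral (hBm : Measurable (Function.uncurry B)) :
    Measurable (kernelAngularIntegral B) := by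
  haveI := isFiniteMeasure_sphereMeasure (E := E)
  have h : Measurable fun q : E × sphere (0 : E) 1 => B (q.1, 0) q.2 :=
    hBm.comp ((measurable_fst.prodMk measurable_const).prodMk measurable_snd)
  exact (h.stronglyMeasurable.integral_prod_right'
    (ν := (sphereMeasure : Measure (sphere (0 : E) 1)))).measurable

/-- A bounded kernel has a bounded angular integral: `A(z) ≤ C_b σ(S^{d-1})`. [folklore] -/
theorem kernelAngularIntegral_le_of_bounded (hB0 : ∀ p ω, 0 ≤ B p ω) {Cb : ℝ}
    (hCb : ∀ p ω, B p ω ≤ Cb) (z : E) :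
    kernelAngularIntegral B z ≤ Cb * (sphereMeasure (E := E)).real univ := by
  haveI := isFiniteMeasure_sphereMeasure (E := E)
  have hCb0 : 0 ≤ Cb * (sphereMeasure (E := E)).real univ := by
    rcases isEmpty_or_nonempty (sphere (0 : E) 1) with h | ⟨⟨ω⟩⟩
    · simp [Measure.real, Subsingleton.elim (univ : Set (sphere (0 : E) 1)) ∅]
    · exact mul_nonneg ((hB0 (z, 0) ω).trans (hCb _ _)) ENNReal.toReal_nonneg
  unfold kernelAngularIntegral
  calc ∫ ω, B (z, 0) ω ∂sphereMeasure ≤ ∫ _ω, Cb ∂(sphereMeasure : Measure (sphere (0 : E) 1)) := by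
        refine integral_mono_of_nonneg (Eventually.of_forall fun ω => hB0 _ _) (integrable_const _)
          (Eventually.of_forall fun ω => hCb _ _)
    _ = Cb * (sphereMeasure (E := E)).real univ := by
        rw [integral_const, smul_eq_mul, mul_comm]

/-- For a bounded nonnegative measurable kernel, `ofReal (A z) = ∫⁻ ofReal (B((z,0),ω)) dω`.
[folklore] -/
theorem ofReal_kernelAngularIntegral (hBm : Measurable (Function.uncurry B))
    (hB0 : ∀ p ω, 0 ≤ B p ω) {Cb : ℝ} (hCb : ∀ p ω, B p ω ≤ Cb) (z : E) :
    ENNReal.ofReal (kernelAngularIntegral B z) =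
      ∫⁻ ω, ENNReal.ofReal (B (z, 0) ω) ∂(sphereMeasure : Measure (sphere (0 : E) 1)) := by
  haveI := isFiniteMeasure_sphereMeasure (E := E)
  unfold kernelAngularIntegral
  refine ofReal_integral_eq_lintegral_ofReal ?_ (Eventually.of_forall fun ω => hB0 _ _)
  have hm : Measurable fun ω : sphere (0 : E) 1 => B (z, 0) ω :=
    hBm.comp (measurable_const.prodMk measurable_id)
  refine (integrable_const Cb).mono' hm.aestronglyMeasurable (Eventually.of_forall fun ω => ?_)
  rw [Real.norm_eq_abs, abs_of_nonneg (hB0 _ _)]; exact hCb _ _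

/-- The angular mass of a ball: `∫⁻_{B̄(0,K)} ofReal A = ∫⁻_{B̄(0,K) × S} ofReal B`. [folklore] -/
theorem setLIntegral_ofReal_kernelAngularIntegral (hBm : Measurable (Function.uncurry B))
    (hB0 : ∀ p ω, 0 ≤ B p ω) {Cb : ℝ} (hCb : ∀ p ω, B p ω ≤ Cb) (K : ℝ) :
    ∫⁻ z in closedBall (0 : E) K, ENNReal.ofReal (kernelAngularIntegral B z) =
      ∫⁻ q in closedBall (0 : E) K ×ˢ (univ : Set (sphere (0 : E) 1)), ENNReal.ofReal (B (q.1, 0) q.2)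
        ∂((volume : Measure E).prod sphereMeasure) := by
  haveI := isFiniteMeasure_sphereMeasure (E := E)
  have h : Measurable fun q : E × sphere (0 : E) 1 => ENNReal.ofReal (B (q.1, 0) q.2) :=
    (hBm.comp ((measurable_fst.prodMk measurable_const).prodMk measurable_snd)).ennreal_ofReal
  rw [← Measure.restrict_univ (μ := (sphereMeasure : Measure (sphere (0 : E) 1))),
    ← Measure.prod_restrict, Measure.restrict_univ, lintegral_prod _ h.aemeasurable]
  refine setLIntegral_congr_fun measurableSet_closedBall fun z _ => ?_
  rw [Measure.restrict_univ]
  exact ofReal_kernelAngularIntegral hBm hB0 hCb z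

end Angular

/-! ## The loss term as a velocity convolution -/

section Loss

variable {B : E × E → sphere (0 : E) 1 → ℝ}

/-- **The loss term is a velocity convolution** for a Galilean-invariant kernel:
`Q⁻_B(g, g)(v) = g(v) ∫ A(v - w) g(w) dw` with `A` the angular integral
(CIP 1994 §5.3 Step 3: "`Q⁻(f,f) = f R(f)`, `R(f) = A ∗ f`"). No integrability is needed.
[cite: CIPDiluteGases1994, §5.3 Step 3 (p. 143)] -/
theorem lossWith_eq_mul_integral_kernelAngularIntegral
    (hsub : ∀ (v w u : E) ω, B (v + u, w + u) ω = B (v, w) ω) (g : E → ℝ) (v : E) :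
    lossWith B g g v = g v * ∫ w, kernelAngularIntegral B (v - w) * g w := by
  unfold lossWith kernelAngularIntegral
  rw [← integral_const_mul]
  refine integral_congr_ae (Eventually.of_forall fun w => ?_)
  have hB : ∀ ω, B (v, w) ω = B (v - w, 0) ω := fun ω => by
    have := hsub (v - w) 0 w ω
    rwa [sub_add_cancel, zero_add] at this
  simp only [hB]
  rw [integral_mul_const]
  ring

/-- **Pointwise domination of the normalised, renormalised loss term by the velocity
convolution**: for `g ≥ 0`, `B ≥ 0` Galilean invariant and `0 ≤ a ≤ 1`,
`‖a Q⁻_B(g,g)(v) / (1 + g(v))‖ₑ ≤ ∫⁻ ofReal (A(v - w) g(w)) dw`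
(`a g/(1+g) ≤ 1`; CIP 1994 §5.3 Lemma 5.3.7: "`Q⁻ⁿ(fⁿ,fⁿ)/(1+fⁿ) ≤ Aₙ ∗ fⁿ`"). [cite: CIPDiluteGases1994, §5.3 Lemma 5.3.7 (p. 148)] -/
theorem enorm_loss_term_le_lintegral (hB0 : ∀ p ω, 0 ≤ B p ω)
    (hsub : ∀ (v w u : E) ω, B (v + u, w + u) ω = B (v, w) ω) {g : E → ℝ} (hg : ∀ w, 0 ≤ g w)
    {a : ℝ} (ha0 : 0 ≤ a) (ha1 : a ≤ 1) (v : E) :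
    ‖a * lossWith B g g v / (1 + g v)‖ₑ ≤
      ∫⁻ w, ENNReal.ofReal (kernelAngularIntegral B (v - w) * g w) := by
  set I : ℝ := ∫ w, kernelAngularIntegral B (v - w) * g w with hI
  have hI0 : 0 ≤ I := integral_nonneg fun w => mul_nonneg (kernelAngularIntegral_nonneg hB0 _) (hg w)
  have h1 : |a * lossWith B g g v / (1 + g v)| ≤ I := by
    rw [lossWith_eq_mul_integral_kernelAngularIntegral hsub, ← hI]
    have hgv := hg v
    rw [abs_of_nonneg (div_nonneg (mul_nonneg ha0 (mul_nonneg hgv hI0)) (by linarith))]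
    rw [div_le_iff₀ (by linarith : (0 : ℝ) < 1 + g v)]
    have : a * g v ≤ 1 + g v := by nlinarith
    nlinarith
  calc ‖a * lossWith B g g v / (1 + g v)‖ₑ = ENNReal.ofReal |a * lossWith B g g v / (1 + g v)| :=
        Real.enorm_eq_ofReal_abs _
    _ ≤ ENNReal.ofReal I := ENNReal.ofReal_le_ofReal h1
    _ = ‖I‖ₑ := (Real.enorm_eq_ofReal hI0).symm
    _ ≤ ∫⁻ w, ‖kernelAngularIntegral B (v - w) * g w‖ₑ := enorm_integral_le_lintegral_enorm _
    _ = ∫⁻ w, ENNReal.ofReal (kernelAngularIntegral B (v - w) * g w) :=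
        lintegral_congr fun w => Real.enorm_eq_ofReal
          (mul_nonneg (kernelAngularIntegral_nonneg hB0 _) (hg w))

end Loss

/-! ## Uniform angular mass of the approximating kernels on balls -/

section AngularMass

variable {B : E × E → sphere (0 : E) 1 → ℝ} {Bseq : ℕ → E × E → sphere (0 : E) 1 → ℝ}

/-- **Uniform local angular mass of the approximating kernels**: for every `K`,
`sup_n ∫_{|z| ≤ K} Aₙ(z) dz < ∞`. This is where the `L¹_loc`-convergence `Bₙ → B` recorded in
`IsDiPernaLionsKernelApproximation.tendsto_setLIntegral` enters (CIP 1994 p. 149: "`aₙ = ‖Aₙ‖_{L¹}`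
can be assumed to be bounded uniformly in `n`"): `∫_{B̄_K × S} Bₙ ≤ ∫_{B̄_K × S} B + ‖Bₙ - B‖`,
the first term finite by local integrability of `B`, the second eventually `≤ 1`, and the finitely
many remaining `n` have bounded kernels. [cite: CIPDiluteGases1994, §5.3 Lemma 5.3.7 (proof, p. 149)] -/
theorem exists_uniform_angular_mass (hB : KineticTheory.IsDiPernaLionsKernel B)
    (hker : IsDiPernaLionsKernelApproximation B Bseq) (K : ℝ) :
    ∃ α : ℝ≥0, ∀ n, ∫⁻ z in closedBall (0 : E) K,
      ENNReal.ofReal (kernelAngularIntegral (Bseq n) z) ≤ α := by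
  haveI := isFiniteMeasure_sphereMeasure (E := E)
  set ν : Measure (E × sphere (0 : E) 1) := (volume : Measure E).prod sphereMeasure with hν
  set S : Set (E × sphere (0 : E) 1) := closedBall (0 : E) K ×ˢ univ with hS
  have hSm : MeasurableSet S := measurableSet_closedBall.prod MeasurableSet.univ
  have hSfin : ν S < ∞ := by
    rw [hν, hS, Measure.prod_prod]
    exact ENNReal.mul_lt_top measure_closedBall_lt_top (measure_lt_top _ _)
  -- the angular masses as integrals over `S`
  set I : ℕ → ℝ≥0∞ := fun n => ∫⁻ q in S, ENNReal.ofReal (Bseq n (q.1, 0) q.2) ∂ν with hI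
  have hIeq : ∀ n, ∫⁻ z in closedBall (0 : E) K, ENNReal.ofReal (kernelAngularIntegral (Bseq n) z) = I n := by
    intro n
    obtain ⟨Cb, hCb⟩ := hker.bounded n
    exact setLIntegral_ofReal_kernelAngularIntegral (hker.isDiPernaLionsKernel n).measurable
      (hker.isDiPernaLionsKernel n).nonneg hCb K
  -- each `I n` is finite
  have hIfin : ∀ n, I n < ∞ := by
    intro n
    obtain ⟨Cb, hCb⟩ := hker.bounded n
    calc I n ≤ ∫⁻ _q in S, ENNReal.ofReal Cb ∂ν :=
          setLIntegral_mono' hSm fun q _ => ENNReal.ofReal_le_ofReal (hCb _ _)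
      _ = ENNReal.ofReal Cb * ν S := setLIntegral_const _ _
      _ < ∞ := ENNReal.mul_lt_top ENNReal.ofReal_lt_top hSfin
  -- the limit kernel has finite mass on `S`
  set I₀ : ℝ≥0∞ := ∫⁻ q in S, ‖B (q.1, 0) q.2‖ₑ ∂ν with hI₀
  have hI₀fin : I₀ < ∞ := by
    have hcpt : IsCompact S := (isCompact_closedBall (0 : E) K).prod isCompact_univ
    have hint := hB.locallyIntegrable.integrableOn_isCompact hcpt
    exact hint.2
  -- `I n ≤ I₀ + Dₙ` with `Dₙ → 0`
  set D : ℕ → ℝ≥0∞ := fun n => ∫⁻ q in S, ‖Bseq n (q.1, 0) q.2 - B (q.1, 0) q.2‖ₑ ∂ν with hD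
  have hDlim : Tendsto D atTop (𝓝 0) := hker.tendsto_setLIntegral K
  have hID : ∀ n, I n ≤ I₀ + D n := by
    intro n
    have hpt : ∀ q : E × sphere (0 : E) 1, ENNReal.ofReal (Bseq n (q.1, 0) q.2) ≤
        ‖B (q.1, 0) q.2‖ₑ + ‖Bseq n (q.1, 0) q.2 - B (q.1, 0) q.2‖ₑ := by
      intro q
      rw [← Real.enorm_eq_ofReal ((hker.isDiPernaLionsKernel n).nonneg _ _)]
      calc ‖Bseq n (q.1, 0) q.2‖ₑ = ‖B (q.1, 0) q.2 + (Bseq n (q.1, 0) q.2 - B (q.1, 0) q.2)‖ₑ := by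
            rw [add_sub_cancel]
        _ ≤ _ := enorm_add_le _ _
    have hBm : Measurable fun q : E × sphere (0 : E) 1 => ‖B (q.1, 0) q.2‖ₑ :=
      (hB.measurable.comp ((measurable_fst.prodMk measurable_const).prodMk measurable_snd)).enorm
    calc I n ≤ ∫⁻ q in S, (‖B (q.1, 0) q.2‖ₑ + ‖Bseq n (q.1, 0) q.2 - B (q.1, 0) q.2‖ₑ) ∂ν :=
          lintegral_mono hpt
      _ = I₀ + D n := lintegral_add_left hBm _
  -- eventually `D n < 1`
  obtain ⟨N, hN⟩ : ∃ N, ∀ n ≥ N, D n < 1 :=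
    eventually_atTop.1 ((tendsto_order.1 hDlim).2 1 zero_lt_one)
  -- the uniform bound
  set total : ℝ≥0∞ := (Finset.range N).sum I + (I₀ + 1) with htotal
  have htot : total < ∞ := by
    refine ENNReal.add_lt_top.2 ⟨?_, ENNReal.add_lt_top.2 ⟨hI₀fin, ENNReal.one_lt_top⟩⟩
    exact ENNReal.sum_lt_top.2 fun n _ => hIfin n
  refine ⟨total.toNNReal, fun n => ?_⟩
  rw [hIeq, ENNReal.coe_toNNReal htot.ne]
  rcases lt_or_ge n N with hn | hn
  · calc I n ≤ (Finset.range N).sum I := Finset.single_le_sum (fun _ _ => bot_le)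
          (Finset.mem_range.2 hn)
      _ ≤ total := le_self_add
  · calc I n ≤ I₀ + D n := hID n
      _ ≤ I₀ + 1 := add_le_add le_rfl (hN n hn).le
      _ ≤ total := le_add_self

end AngularMass

/-! ## Tonelli on the slab for velocity kernels -/

section Tonelli

/-- **Exchanging the velocity integrals on a slab.** For measurable `H ≥ 0` on `E × E` and
`Ψ ≥ 0` on `ℝ × E × E`,
`∫_{(t,x,v) ∈ slab} ∫_w H(v, w) Ψ(t, x, w) = ∫_{(t,x,w) ∈ slab} Ψ(t,x,w) ∫_v H(v, w)`
(Tonelli; the slab measure is `dt|_{(0,T)} ⊗ dx ⊗ dv`). [folklore] -/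
theorem lintegral_slab_kernel_swap {H : E → E → ℝ≥0∞} (hH : Measurable (Function.uncurry H))
    {Ψ : ℝ × E × E → ℝ≥0∞} (hΨ : Measurable Ψ) (T : ℝ) :
    ∫⁻ z, (∫⁻ w, H z.2.2 w * Ψ (z.1, z.2.1, w)) ∂(slabMeasure E T) =
      ∫⁻ q, Ψ q * (∫⁻ v, H v q.2.2) ∂(slabMeasure E T) := by
  rw [slabMeasure_eq_prod]
  -- both sides as iterated integrals `∫ dt ∫ dx ∫ ∫`
  have hL : Measurable fun z : ℝ × E × E => ∫⁻ w, H z.2.2 w * Ψ (z.1, z.2.1, w) := by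
    have h : Measurable fun p : (ℝ × E × E) × E => H p.1.2.2 p.2 * Ψ (p.1.1, p.1.2.1, p.2) :=
      (hH.comp (measurable_fst.snd.snd.prodMk measurable_snd)).mul
        (hΨ.comp (measurable_fst.fst.prodMk (measurable_fst.snd.fst.prodMk measurable_snd)))
    exact h.lintegral_prod_right'
  have hRi : Measurable fun q : ℝ × E × E => Ψ q * ∫⁻ v, H v q.2.2 := by
    have h : Measurable fun p : (ℝ × E × E) × E => H p.2 p.1.2.2 :=
      hH.comp (measurable_snd.prodMk measurable_fst.snd.snd)
    exact hΨ.mul h.lintegral_prod_right'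
  rw [lintegral_prod _ hL.aemeasurable, lintegral_prod _ hRi.aemeasurable]
  refine lintegral_congr fun t => ?_
  -- the slice at time `t`
  set G1 : E × E → ℝ≥0∞ := fun y => ∫⁻ w, H y.2 w * Ψ (t, y.1, w) with hG1
  set G2 : E × E → ℝ≥0∞ := fun y => Ψ (t, y) * ∫⁻ v, H v y.2 with hG2
  have hG1m : Measurable G1 := hL.comp (measurable_const.prodMk measurable_id)
  have hG2m : Measurable G2 := hRi.comp (measurable_const.prodMk measurable_id)
  show ∫⁻ y, G1 y ∂((volume : Measure E).prod volume) = ∫⁻ y, G2 y ∂((volume : Measure E).prod volume)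
  rw [lintegral_prod _ hG1m.aemeasurable, lintegral_prod _ hG2m.aemeasurable]
  refine lintegral_congr fun x => ?_
  simp only [hG1, hG2]
  -- `∫_v ∫_w H v w Ψ(t,x,w) = ∫_w Ψ(t,x,w) ∫_v H v w`
  have hsw : AEMeasurable (Function.uncurry fun (v w : E) => H v w * Ψ (t, x, w))
      ((volume : Measure E).prod volume) :=
    (hH.mul (hΨ.comp (measurable_const.prodMk (measurable_const.prodMk measurable_snd)))).aemeasurable
  rw [lintegral_lintegral_swap hsw]
  refine lintegral_congr fun w => ?_
  have hm : Measurable fun v : E => H v w := hH.comp (measurable_id.prodMk measurable_const)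
  rw [mul_comm, ← lintegral_mul_const _ hm]

/-- The restricted slab `(0,T) × E × B̄_R` is the slab restricted to `{|v| ≤ R}`. [folklore] -/
theorem volume_restrict_slab_ball (T R : ℝ) :
    (volume : Measure (ℝ × E × E)).restrict (Ioo 0 T ×ˢ (univ ×ˢ closedBall (0 : E) R)) =
      (slabMeasure E T).restrict {z : ℝ × E × E | z.2.2 ∈ closedBall (0 : E) R} := by
  have hS : MeasurableSet {z : ℝ × E × E | z.2.2 ∈ closedBall (0 : E) R} :=
    measurableSet_closedBall.preimage measurable_snd.snd
  rw [slabMeasure_def, Measure.restrict_restrict hS]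
  congr 1
  ext z
  simp only [mem_prod, mem_univ, true_and, mem_inter_iff, mem_setOf_eq]
  tauto

/-- Integrals over the restricted slab are integrals over the slab with the indicator of
`{|v| ≤ R}`, hence bounded by slab integrals. [folklore] -/
theorem lintegral_slab_ball_eq (T R : ℝ) (Φ : ℝ × E × E → ℝ≥0∞) :
    ∫⁻ z, Φ z ∂((volume : Measure (ℝ × E × E)).restrict (Ioo 0 T ×ˢ (univ ×ˢ closedBall (0 : E) R))) =
      ∫⁻ z, {z : ℝ × E × E | z.2.2 ∈ closedBall (0 : E) R}.indicator Φ z ∂(slabMeasure E T) := by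
  have hS : MeasurableSet {z : ℝ × E × E | z.2.2 ∈ closedBall (0 : E) R} :=
    measurableSet_closedBall.preimage measurable_snd.snd
  rw [volume_restrict_slab_ball, lintegral_indicator hS]

end Tonelli

/-! ## The velocity convolution `A ∗ F` and its three parts -/

section Convolution

variable {A : E → ℝ} {F : ℝ × E × E → ℝ}

/-- Splitting of the velocity convolution into the near part (`|v - w| ≤ K`) and the far part.
[folklore] -/
theorem lintegral_conv_eq_near_add_far (A : E → ℝ) (F : ℝ × E × E → ℝ) (K : ℝ) (z : ℝ × E × E) :
    ∫⁻ w, ENNReal.ofReal (A (z.2.2 - w) * F (z.1, z.2.1, w)) =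
      (∫⁻ w in closedBall z.2.2 K, ENNReal.ofReal (A (z.2.2 - w) * F (z.1, z.2.1, w))) +
        ∫⁻ w in (closedBall z.2.2 K)ᶜ, ENNReal.ofReal (A (z.2.2 - w) * F (z.1, z.2.1, w)) :=
  (lintegral_add_compl _ measurableSet_closedBall).symm

/-- Splitting of the near part according to the height of `F`: `F = F ∧ M + (F - F ∧ M)`.
[folklore] -/
theorem lintegral_near_eq_bdd_add_tail (hA0 : ∀ u, 0 ≤ A u) (hF0 : ∀ q, 0 ≤ F q)
    (hAm : Measurable A) (hFm : Measurable F) (K : ℝ) {M : ℝ} (hM : 0 ≤ M) (z : ℝ × E × E) :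
    (∫⁻ w in closedBall z.2.2 K, ENNReal.ofReal (A (z.2.2 - w) * F (z.1, z.2.1, w))) =
      (∫⁻ w in closedBall z.2.2 K, ENNReal.ofReal (A (z.2.2 - w) * min (F (z.1, z.2.1, w)) M)) +
        ∫⁻ w in closedBall z.2.2 K,
          ENNReal.ofReal (A (z.2.2 - w) * (F (z.1, z.2.1, w) - min (F (z.1, z.2.1, w)) M)) := by
  have hm : Measurable fun w => ENNReal.ofReal (A (z.2.2 - w) * min (F (z.1, z.2.1, w)) M) :=
    ((hAm.comp (measurable_const.sub measurable_id)).mul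
      ((hFm.comp (measurable_const.prodMk (measurable_const.prodMk measurable_id))).min
        measurable_const)).ennreal_ofReal
  rw [← lintegral_add_left hm]
  refine lintegral_congr fun w => ?_
  have h1 : 0 ≤ A (z.2.2 - w) * min (F (z.1, z.2.1, w)) M :=
    mul_nonneg (hA0 _) (le_min (hF0 _) hM)
  have h2 : 0 ≤ A (z.2.2 - w) * (F (z.1, z.2.1, w) - min (F (z.1, z.2.1, w)) M) :=
    mul_nonneg (hA0 _) (sub_nonneg.2 (min_le_left _ _))
  rw [← ENNReal.ofReal_add h1 h2]
  congr 1
  ring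

/-- Change of variables `u = v - w` in the near part: `∫_{|v-w| ≤ K} g(v - w) dw = ∫_{|u| ≤ K} g`.
[folklore] -/
theorem setLIntegral_closedBall_comp_sub_left (g : E → ℝ≥0∞) (v : E) (K : ℝ) :
    ∫⁻ w in closedBall v K, g (v - w) = ∫⁻ u in closedBall (0 : E) K, g u := by
  rw [← lintegral_indicator measurableSet_closedBall, ← lintegral_indicator measurableSet_closedBall,
    ← lintegral_sub_left_eq_self ((closedBall (0 : E) K).indicator g) v]
  refine lintegral_congr fun w => ?_
  have hmem : w ∈ closedBall v K ↔ v - w ∈ closedBall (0 : E) K := by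
    rw [mem_closedBall, mem_closedBall, dist_zero_right, dist_eq_norm, ← norm_neg, neg_sub]
  by_cases hw : w ∈ closedBall v K
  · rw [indicator_of_mem hw, indicator_of_mem (hmem.1 hw)]
  · rw [indicator_of_notMem hw, indicator_of_notMem (fun h => hw (hmem.2 h))]

/-- **The bounded near part**: `∫_{|v-w| ≤ K} A(v-w) (F ∧ M)(w) dw ≤ M ∫_{|u| ≤ K} A`. [folklore] -/
theorem lintegral_near_bdd_le (hA0 : ∀ u, 0 ≤ A u) (K M : ℝ) (z : ℝ × E × E) :
    (∫⁻ w in closedBall z.2.2 K, ENNReal.ofReal (A (z.2.2 - w) * min (F (z.1, z.2.1, w)) M)) ≤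
      ENNReal.ofReal M * ∫⁻ u in closedBall (0 : E) K, ENNReal.ofReal (A u) := by
  rw [← setLIntegral_closedBall_comp_sub_left (fun u => ENNReal.ofReal (A u)) z.2.2 K,
    ← lintegral_const_mul' _ _ ENNReal.ofReal_ne_top]
  refine lintegral_mono fun w => ?_
  rw [← ENNReal.ofReal_mul' (hA0 _)]
  exact ENNReal.ofReal_le_ofReal
    ((mul_le_mul_of_nonneg_left (min_le_right _ _) (hA0 _)).trans_eq (mul_comm _ _))

/-- **Tonelli for the near part of the velocity convolution on a slab**: for measurable `Ψ ≥ 0`,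
`∫_{slab} ∫_{|v-w| ≤ K} A(v-w) Ψ(t,x,w) dw = (∫_{|u| ≤ K} A) ∫_{slab} Ψ`. [folklore] -/
theorem lintegral_slab_near_conv_eq (hAm : Measurable A) {Ψ : ℝ × E × E → ℝ≥0∞} (hΨ : Measurable Ψ)
    (T K : ℝ) :
    ∫⁻ z, (∫⁻ w in closedBall z.2.2 K, ENNReal.ofReal (A (z.2.2 - w)) * Ψ (z.1, z.2.1, w))
        ∂(slabMeasure E T) =
      (∫⁻ u in closedBall (0 : E) K, ENNReal.ofReal (A u)) * ∫⁻ q, Ψ q ∂(slabMeasure E T) := by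
  set G : E → ℝ≥0∞ := (closedBall (0 : E) K).indicator fun u => ENNReal.ofReal (A u) with hG
  have hGm : Measurable G := hAm.ennreal_ofReal.indicator measurableSet_closedBall
  have hH : Measurable (Function.uncurry fun v w : E => G (v - w)) :=
    hGm.comp (measurable_fst.sub measurable_snd)
  -- rewrite the near part with the translated indicator kernel
  have hnear : ∀ z : ℝ × E × E,
      (∫⁻ w in closedBall z.2.2 K, ENNReal.ofReal (A (z.2.2 - w)) * Ψ (z.1, z.2.1, w)) =
        ∫⁻ w, G (z.2.2 - w) * Ψ (z.1, z.2.1, w) := by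
    intro z
    rw [← lintegral_indicator measurableSet_closedBall]
    refine lintegral_congr fun w => ?_
    have hmem : w ∈ closedBall z.2.2 K ↔ z.2.2 - w ∈ closedBall (0 : E) K := by
      rw [mem_closedBall, mem_closedBall, dist_zero_right, dist_eq_norm, ← norm_neg, neg_sub]
    by_cases hw : w ∈ closedBall z.2.2 K
    · rw [indicator_of_mem hw, hG, indicator_of_mem (hmem.1 hw)]
    · rw [indicator_of_notMem hw, hG, indicator_of_notMem (fun h => hw (hmem.2 h)), zero_mul]
  rw [lintegral_congr fun z => hnear z, lintegral_slab_kernel_swap hH hΨ T]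
  have hconst : ∀ w : E, ∫⁻ v, G (v - w) = ∫⁻ u in closedBall (0 : E) K, ENNReal.ofReal (A u) := by
    intro w
    rw [lintegral_sub_right_eq_self G w, hG, lintegral_indicator measurableSet_closedBall]
  rw [lintegral_congr fun q => by rw [hconst], lintegral_mul_const _ hΨ, mul_comm]

/-- **The far part is small by the growth condition** (CIP 1994 p. 150: for `|ξ| ≤ R` and
`K > R`, `{ξ_* : |ξ - ξ_*| ≥ K} ⊂ {|ξ_*| ≥ K - R}`, and (3.12)): if `K ≥ R + ρ` and
`∫_{B̄(u,R)} A ≤ ε (1 + |u|²)` for `|u| ≥ ρ`, then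
`∫_{(0,T)×E×B̄_R} ∫_{|v-w| > K} A(v-w) F(w) ≤ ε ∫_{slab} (1 + |w|²) F`. [cite: CIPDiluteGases1994, §5.3 Lemma 5.3.7 (proof, p. 150)] -/
theorem lintegral_far_le_of_growth (hAm : Measurable A) (hA0 : ∀ u, 0 ≤ A u) (hFm : Measurable F)
    (hF0 : ∀ q, 0 ≤ F q) {T R K ρ ε : ℝ} (hε : 0 ≤ ε) (hK : R + ρ ≤ K)
    (hgrowth : ∀ u : E, ρ ≤ ‖u‖ →
      ∫⁻ z in closedBall u R, ENNReal.ofReal (A z) ≤ ENNReal.ofReal (ε * (1 + ‖u‖ ^ 2))) :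
    ∫⁻ z, (∫⁻ w in (closedBall z.2.2 K)ᶜ, ENNReal.ofReal (A (z.2.2 - w) * F (z.1, z.2.1, w)))
        ∂((volume : Measure (ℝ × E × E)).restrict (Ioo 0 T ×ˢ (univ ×ˢ closedBall (0 : E) R))) ≤
      ENNReal.ofReal ε * ∫⁻ q, ENNReal.ofReal ((1 + ‖q.2.2‖ ^ 2) * F q) ∂(slabMeasure E T) := by
  -- the kernel `H v w = 1_{|v| ≤ R} 1_{|v - w| > K} A(v - w)`
  set G : E → ℝ≥0∞ := (closedBall (0 : E) K)ᶜ.indicator fun u => ENNReal.ofReal (A u) with hG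
  have hGm : Measurable G := hAm.ennreal_ofReal.indicator measurableSet_closedBall.compl
  set H : E → E → ℝ≥0∞ := fun v w => (closedBall (0 : E) R).indicator (fun _ => (1 : ℝ≥0∞)) v * G (v - w)
    with hH
  have hHm : Measurable (Function.uncurry H) :=
    ((measurable_const.indicator measurableSet_closedBall).comp measurable_fst).mul
      (hGm.comp (measurable_fst.sub measurable_snd))
  have hΨm : Measurable fun q : ℝ × E × E => ENNReal.ofReal (F q) := hFm.ennreal_ofReal
  -- the integrand on the restricted slab in terms of `H`
  rw [lintegral_slab_ball_eq]
  have hpt : ∀ z : ℝ × E × E, {z : ℝ × E × E | z.2.2 ∈ closedBall (0 : E) R}.indicator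
      (fun z => ∫⁻ w in (closedBall z.2.2 K)ᶜ, ENNReal.ofReal (A (z.2.2 - w) * F (z.1, z.2.1, w))) z =
      ∫⁻ w, H z.2.2 w * ENNReal.ofReal (F (z.1, z.2.1, w)) := by
    intro z
    by_cases hz : z ∈ {z : ℝ × E × E | z.2.2 ∈ closedBall (0 : E) R}
    · rw [indicator_of_mem hz, ← lintegral_indicator measurableSet_closedBall.compl]
      refine lintegral_congr fun w => ?_
      have hmem : w ∈ (closedBall z.2.2 K)ᶜ ↔ z.2.2 - w ∈ (closedBall (0 : E) K)ᶜ := by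
        rw [mem_compl_iff, mem_compl_iff, mem_closedBall, mem_closedBall, dist_zero_right,
          dist_eq_norm, ← norm_neg, neg_sub]
      simp only [hH, hG, indicator_of_mem (show z.2.2 ∈ closedBall (0 : E) R from hz), one_mul]
      by_cases hw : w ∈ (closedBall z.2.2 K)ᶜ
      · rw [indicator_of_mem hw, indicator_of_mem (hmem.1 hw), ENNReal.ofReal_mul (hA0 _)]
      · rw [indicator_of_notMem hw, indicator_of_notMem (fun h => hw (hmem.2 h)), zero_mul]
    · rw [indicator_of_notMem hz]
      have : ∀ w, H z.2.2 w = 0 := fun w => by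
        simp only [hH, indicator_of_notMem (show z.2.2 ∉ closedBall (0 : E) R from hz), zero_mul]
      simp [this]
  rw [lintegral_congr fun z => hpt z, lintegral_slab_kernel_swap hHm hΨm T]
  -- bound `∫ H(v, w) dv ≤ ε (1 + |w|²)`
  have hinner : ∀ w : E, ∫⁻ v, H v w ≤ ENNReal.ofReal (ε * (1 + ‖w‖ ^ 2)) := by
    intro w
    rcases le_or_gt (‖w‖ + R) K with hw | hw
    · -- near the origin: the kernel vanishes identically
      have h0 : ∀ v, H v w = 0 := by
        intro v
        simp only [hH, hG]
        by_cases hv : v ∈ closedBall (0 : E) R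
        · have : v - w ∉ (closedBall (0 : E) K)ᶜ := by
            rw [mem_compl_iff, not_not, mem_closedBall, dist_zero_right]
            rw [mem_closedBall, dist_zero_right] at hv
            calc ‖v - w‖ ≤ ‖v‖ + ‖w‖ := norm_sub_le _ _
              _ ≤ K := by linarith
          rw [indicator_of_notMem this, mul_zero]
        · rw [indicator_of_notMem hv, zero_mul]
      simp [h0]
    · -- far from the origin: drop the cut-off and use the growth condition at `-w`
      have hρw : ρ ≤ ‖-w‖ := by rw [norm_neg]; linarith
      set G' : E → ℝ≥0∞ := (closedBall (-w) R).indicator fun u => ENNReal.ofReal (A u) with hG'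
      have hle : ∀ v, H v w ≤ G' (v - w) := by
        intro v
        simp only [hH, hG, hG']
        by_cases hv : v ∈ closedBall (0 : E) R
        · have hv' : v - w ∈ closedBall (-w) R := by
            rw [mem_closedBall, dist_eq_norm, sub_neg_eq_add, sub_add_cancel]
            rwa [mem_closedBall, dist_zero_right] at hv
          rw [indicator_of_mem hv, one_mul, indicator_of_mem hv']
          exact indicator_le_self _ _ _
        · rw [indicator_of_notMem hv, zero_mul]; exact bot_le
      calc ∫⁻ v, H v w ≤ ∫⁻ v, G' (v - w) := lintegral_mono hle
        _ = ∫⁻ u, G' u := lintegral_sub_right_eq_self G' w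
        _ = ∫⁻ u in closedBall (-w) R, ENNReal.ofReal (A u) := lintegral_indicator measurableSet_closedBall _
        _ ≤ ENNReal.ofReal (ε * (1 + ‖-w‖ ^ 2)) := hgrowth (-w) hρw
        _ = ENNReal.ofReal (ε * (1 + ‖w‖ ^ 2)) := by rw [norm_neg]
  calc ∫⁻ q, ENNReal.ofReal (F q) * (∫⁻ v, H v q.2.2) ∂(slabMeasure E T)
      ≤ ∫⁻ q, ENNReal.ofReal (F q) * ENNReal.ofReal (ε * (1 + ‖q.2.2‖ ^ 2)) ∂(slabMeasure E T) :=
        lintegral_mono fun q => mul_le_mul_of_nonneg_left (hinner q.2.2) bot_le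
    _ = ENNReal.ofReal ε * ∫⁻ q, ENNReal.ofReal ((1 + ‖q.2.2‖ ^ 2) * F q) ∂(slabMeasure E T) := by
        rw [← lintegral_const_mul' _ _ ENNReal.ofReal_ne_top]
        refine lintegral_congr fun q => ?_
        rw [← ENNReal.ofReal_mul (hF0 q), ← ENNReal.ofReal_mul hε]
        congr 1; ring

end Convolution

/-! ## Application to the approximating sequence -/

section Approx

variable {δ : ℝ} {B : E × E → sphere (0 : E) 1 → ℝ} {f : ℝ → E → E → ℝ}

/-- The time-clamped approximate solution `(t, x, w) ↦ f(max t 0, x, w)` is measurable and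
nonnegative. [folklore] -/
theorem IsDiPernaLionsApproximateSolution.measurable_clamp_uncurry
    (hf : IsDiPernaLionsApproximateSolution δ B f) :
    Measurable (fun q : ℝ × E × E => f (max q.1 0) q.2.1 q.2.2) ∧
      ∀ q : ℝ × E × E, 0 ≤ f (max q.1 0) q.2.1 q.2.2 :=
  ⟨(hf.continuous_clamp continuous_fst (continuous_fst.comp continuous_snd)
    (continuous_snd.comp continuous_snd)).measurable, fun _ => hf.nonneg _ (le_max_right _ _) _ _⟩

/-- **The normalised renormalised loss term is dominated by the velocity convolution**
`∫⁻ ofReal (Aₙ(v - w) fⁿ(t, x, w)) dw` at every point of `(0, ∞) × E × E`. [cite: CIPDiluteGases1994, §5.3 Lemma 5.3.7 (p. 148)] -/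
theorem IsDiPernaLionsApproximateSolution.enorm_loss_term_le
    (hf : IsDiPernaLionsApproximateSolution δ B f) (hδ : 0 ≤ δ)
    (hBk : KineticTheory.IsDiPernaLionsKernel B) (z : ℝ × E × E) (hz : 0 < z.1) :
    ‖(1 + δ * ∫ w, |f z.1 z.2.1 w|)⁻¹ * lossWith B (f z.1 z.2.1) (f z.1 z.2.1) z.2.2 /
        (1 + f z.1 z.2.1 z.2.2)‖ₑ ≤
      ∫⁻ w, ENNReal.ofReal (kernelAngularIntegral B (z.2.2 - w) * f (max z.1 0) z.2.1 w) := by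
  obtain ⟨ha0, ha1⟩ := normalisingFactor_pos_and_le_one hδ (f z.1 z.2.1)
  have h := enorm_loss_term_le_lintegral hBk.nonneg hBk.sub_right (g := f z.1 z.2.1)
    (fun w => hf.nonneg _ hz.le _ _) ha0.le ha1 z.2.2
  rwa [max_eq_left hz.le]

/-- **Slab bounds from the mass–moment–entropy bound**: for a weight `0 ≤ g ≤
1 + |x|² + |w|² + |log f|`, `∫_{slab} f g ≤ T C`. [folklore] -/
theorem lintegral_slab_weight_le {fseq : ℕ → ℝ → E → E → ℝ} {δs : ℕ → ℝ}
    {Bseq : ℕ → E × E → sphere (0 : E) 1 → ℝ}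
    (hsol : ∀ n, IsDiPernaLionsApproximateSolution (δs n) (Bseq n) (fseq n)) {T C : ℝ}
    (hC : ∀ n, ∀ t ∈ Icc 0 T, ∫⁻ z : E × E, ENNReal.ofReal (fseq n t z.1 z.2 *
      (1 + ‖z.1‖ ^ 2 + ‖z.2‖ ^ 2 + |log (fseq n t z.1 z.2)|)) ∂(volume.prod volume) ≤ ENNReal.ofReal C)
    (n : ℕ) {g : ℝ × E × E → ℝ} (hgm : Measurable g)
    (hg : ∀ q : ℝ × E × E, 0 < q.1 → 0 ≤ g q ∧
      g q ≤ 1 + ‖q.2.1‖ ^ 2 + ‖q.2.2‖ ^ 2 + |log (fseq n q.1 q.2.1 q.2.2)|) :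
    ∫⁻ q, ENNReal.ofReal (fseq n (max q.1 0) q.2.1 q.2.2 * g q) ∂(slabMeasure E T) ≤
      ENNReal.ofReal T * ENNReal.ofReal C := by
  obtain ⟨hFm, hF0⟩ := (hsol n).measurable_clamp_uncurry
  have hmeas : AEMeasurable (fun q : ℝ × E × E => ENNReal.ofReal (fseq n (max q.1 0) q.2.1 q.2.2 * g q))
      (slabMeasure E T) := (hFm.mul hgm).ennreal_ofReal.aemeasurable
  refine lintegral_slab_le hmeas fun t ht => ?_
  refine le_trans (lintegral_mono fun z => ENNReal.ofReal_le_ofReal ?_) (hC n t ⟨ht.1.le, ht.2.le⟩)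
  have h := hg (t, z) ht.1
  simp only [max_eq_left ht.1.le] at h ⊢
  exact mul_le_mul_of_nonneg_left h.2 ((hsol n).nonneg t ht.1.le _ _)

/-- **The height tail is the equi-integrability tail**: `ofReal (F - F ∧ M) ≤ ‖1_{M ≤ ‖F‖} F‖ₑ`
pointwise for `F ≥ 0`. [folklore] -/
theorem ofReal_sub_min_le_enorm_indicator {α : Type*} {F : α → ℝ} (hF0 : ∀ q, 0 ≤ F q) (M : ℝ≥0)
    (q : α) : ENNReal.ofReal (F q - min (F q) M) ≤ ‖{q | M ≤ ‖F q‖₊}.indicator F q‖ₑ := by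
  by_cases hq : (M : ℝ) ≤ F q
  · have hmem : q ∈ {q | M ≤ ‖F q‖₊} := by
      show M ≤ ‖F q‖₊
      rw [← NNReal.coe_le_coe, coe_nnnorm, Real.norm_eq_abs, abs_of_nonneg (hF0 q)]
      exact hq
    rw [indicator_of_mem hmem, Real.enorm_eq_ofReal (hF0 q)]
    refine ENNReal.ofReal_le_ofReal ?_
    have : 0 ≤ min (F q) (M : ℝ) := le_min (hF0 q) (NNReal.coe_nonneg M)
    linarith
  · rw [min_eq_left (le_of_lt (lt_of_not_ge hq)), sub_self, ENNReal.ofReal_zero]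
    exact bot_le

/-- **The growth condition in lower-Lebesgue-integral form**: for a bounded measurable
nonnegative angular integral, `∫⁻_{B̄(u,R)} ofReal A = ofReal ∫_{B̄(u,R)} A`, so (3.12) reads
`∫⁻_{B̄(u,R)} ofReal A ≤ ofReal (ε (1 + |u|²))` for `|u| ≥ ρ`. [folklore] -/
theorem setLIntegral_ofReal_le_of_growth {A : E → ℝ} (hAm : Measurable A) (hA0 : ∀ u, 0 ≤ A u)
    {CA : ℝ} (hCA : ∀ u, A u ≤ CA) {R ε ρ : ℝ}
    (hgrowth : ∀ u : E, ρ ≤ ‖u‖ → (1 + ‖u‖ ^ 2)⁻¹ * ∫ z in closedBall u R, A z ≤ ε) (u : E)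
    (hu : ρ ≤ ‖u‖) :
    ∫⁻ z in closedBall u R, ENNReal.ofReal (A z) ≤ ENNReal.ofReal (ε * (1 + ‖u‖ ^ 2)) := by
  have hint : IntegrableOn A (closedBall u R) :=
    Measure.integrableOn_of_bounded (M := CA) measure_closedBall_lt_top.ne hAm.aestronglyMeasurable
      (Eventually.of_forall fun z => by rw [Real.norm_eq_abs, abs_of_nonneg (hA0 z)]; exact hCA z)
  rw [← ofReal_integral_eq_lintegral_ofReal hint (Eventually.of_forall fun z => hA0 z)]
  refine ENNReal.ofReal_le_ofReal ?_
  have h := hgrowth u hu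
  have hpos : (0 : ℝ) < 1 + ‖u‖ ^ 2 := by positivity
  rw [inv_mul_le_iff₀ hpos] at h
  linarith

end Approx

end Literature.MathematicalPhysics.KineticTheory
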